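import Literature.Geometry.GeometricMeasureTheory.Currents
import Mathlib.Geometry.Manifold.PartitionOfUnity
import Mathlib.Analysis.InnerProductSpace.Orientation

/-!
# Currents: mass bounds, lower semicontinuity of mass and normal mass, flat versus weak convergence

Proved bricks of the "complete and lower semicontinuous" half of the Federer–Fleming compactness
theorem [Federer1969, 4.2.17 (2)] for the objects of
`Literature.Geometry.GeometricMeasureTheory.Currents` (test forms `TestForm Ω m`, currents
`Current Ω m`, `Current.mass`, `Current.normalMass`, `Current.integralFlatNorm`):

* `Current.ofReal_apply_le_mul_mass` — `T(φ) ≤ c · 𝐌(T)` when `‖φ(x)‖ ≤ c` [4.1.7];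
  `Current.eq_zero_of_mass_eq_zero` — `𝐌(T) = 0 ⟹ T = 0`.
* `Current.mass_le_liminf`, `Current.normalMass_le_liminf` — `𝐌` and `𝐍 = 𝐌 + 𝐌 ∘ ∂` are lower
  semicontinuous under weak (pointwise) convergence of currents ("Since 𝐍 is a lowersemicontinuous
  function …", proof of 4.2.17).
* `Current.ofReal_apply_le_integralFlatNorm` — `T(φ) = R(φ) + S(dφ) ≤ 𝐌(R) + 𝐌(S)` for
  `T = R + ∂S` and `‖φ‖, ‖dφ‖ ≤ 1` pointwise [4.1.12], hence `T(φ) ≤ 𝓕(T)`;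
  `Current.integralFlatNorm_le_mass` (`𝓕(T) ≤ 𝐌(T)` on `𝓡_m`),
  `Current.integralFlatNorm_boundary_le_mass` (`𝓕(∂S) ≤ 𝐌(S)` on `𝓡_{m+1}`) [4.1.24].
* `Current.tendsto_apply_of_tendsto_integralFlatNorm` — convergence in the integral flat norm
  implies weak convergence; `Current.normalMass_le_of_tendsto_integralFlatNorm` — an 𝓕-limit of
  currents with `𝐍 ≤ c` has `𝐍 ≤ c` (the bound `𝐍(T') ≤ c` in the conclusion of 4.2.17 (2)).
* `Current.apply_eq_zero_of_forall_exists_nhds`, `Current.apply_eq_zero_of_disjoint_support`,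
  `Current.eq_zero_of_support_eq_empty` — localisation of currents by smooth partitions of unity
  (finite-dimensional `E`): `T(φ) = 0` when `spt φ` misses `spt T`; a current with empty support
  is zero [4.1.1].
* `vectorCurrent_neg`, `currentOfIntegration_neg`, `IsRectifiableData.neg`,
  `Current.IsRectifiable.neg`, `Current.IsIntegral.neg`, `Current.IsIntegralFlatChain.neg`,
  `Current.integralFlatNorm_neg`, `Current.eq_zero_of_integralFlatNorm_eq_zero` — `𝓡_m`, `𝐈_m`,
  `𝓕_m` are closed under `T ↦ -T`, `𝓕(-T) = 𝓕(T)`, and `𝓕(T) = 0 ⟹ T = 0` (symmetry and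
  definiteness of the metric `𝓕(T₁ − T₂)` of 4.1.24);
  `support_currentOfIntegration_subset_closure` (`spt [W, θ, ξ] ⊆ closure W`) and
  `IsRectifiableData.mass_le` (`𝐌([W, θ, ξ]) ≤ ∫_W |θ| d𝓗^m`, via `‖ξ₁ ∧ ⋯ ∧ ξₘ‖ ≤ 1` for
  orthonormal frames) [4.1.28]; `norm_frameVector_eq_one` (`‖ξ₁ ∧ ⋯ ∧ ξₘ‖ = 1`, by the volume
  form of the plane `span ξ` pulled back along the orthogonal projection) [1.8.1].

Source: H. Federer, *Geometric Measure Theory*, Springer 1969 (`Federer1969`), 4.1.1, 4.1.7,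
4.1.12, 4.1.24, 4.1.28, 4.2.17 (held copy `lit book:federernd-geometric-measure-theory`, PDF
pp. 294, 301, 309–310, 321–326, 351).

## Not here

The deep half of 4.2.17 (total boundedness via the deformation theorem 4.2.9, and the closure
theorem 4.2.16) — the named fact `Federer1969_compactness_integralCurrents` of `Currents.lean`
stays undischarged.
-/

open scoped Distributions ENNReal NNReal Topology
open MeasureTheory TopologicalSpace Set Filter

namespace Literature.Geometry.GeometricMeasureTheory

-- Nested operator-norm instances on (duals of) `E [⋀^Fin m]→L[ℝ] ℝ`, as in `Currents.lean`.
set_option maxSynthPendingDepth 2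

variable {E : Type*} [NormedAddCommGroup E] [NormedSpace ℝ E] {Ω : Opens E} {m : ℕ}

/-! ### Mass bounds -/

/-- Every test form has finite comass: there is `C > 0` with `‖φ(x)‖ ≤ C` for all `x`
(a continuous compactly supported form is bounded). [folklore] -/
theorem TestForm.exists_pos_forall_norm_le (φ : TestForm Ω m) :
    ∃ C : ℝ, 0 < C ∧ ∀ x, ‖φ x‖ ≤ C := by
  obtain ⟨C, hC⟩ := φ.continuous.bounded_above_of_compact_support φ.hasCompactSupport
  exact ⟨max C 1, lt_of_lt_of_le one_pos (le_max_right _ _),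
    fun x => (hC x).trans (le_max_left _ _)⟩

/-- **`T(φ) ≤ c · 𝐌(T)` whenever `‖φ(x)‖ ≤ c` for all `x`** (homogeneity of the defining
supremum "𝐌(T) = sup {T(φ) : 𝐌(φ) ≤ 1}"). [cite: Federer1969, 4.1.7] -/
theorem Current.ofReal_apply_le_mul_mass (T : Current Ω m) {φ : TestForm Ω m} {c : ℝ}
    (hc : 0 < c) (hφ : ∀ x, ‖φ x‖ ≤ c) :
    ENNReal.ofReal (T φ) ≤ ENNReal.ofReal c * T.mass := by
  have hψ : ∀ x, ‖(c⁻¹ • φ) x‖ ≤ 1 := fun x => by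
    rw [show (c⁻¹ • φ) x = c⁻¹ • φ x from rfl, norm_smul, norm_inv, Real.norm_of_nonneg hc.le]
    exact (inv_mul_le_iff₀ hc).2 (by simpa using hφ x)
  have h1 := T.ofReal_apply_le_mass hψ
  have h2 : T φ = c * T (c⁻¹ • φ) := by
    rw [map_smul, smul_eq_mul, ← mul_assoc, mul_inv_cancel₀ hc.ne', one_mul]
  rw [h2, ENNReal.ofReal_mul hc.le]
  gcongr

/-- `|T(φ)| ≤ c · 𝐌(T)` whenever `‖φ(x)‖ ≤ c` for all `x` (apply the previous bound to `φ` and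
`-φ`). [cite: Federer1969, 4.1.7] -/
theorem Current.ofReal_abs_apply_le_mul_mass (T : Current Ω m) {φ : TestForm Ω m} {c : ℝ}
    (hc : 0 < c) (hφ : ∀ x, ‖φ x‖ ≤ c) :
    ENNReal.ofReal |T φ| ≤ ENNReal.ofReal c * T.mass := by
  rcases le_total 0 (T φ) with h | h
  · rw [abs_of_nonneg h]
    exact T.ofReal_apply_le_mul_mass hc hφ
  · rw [abs_of_nonpos h, ← map_neg]
    exact T.ofReal_apply_le_mul_mass hc fun x => by simpa using hφ x

/-- `|T(φ)| ≤ c · 𝐌(T)` as a real inequality, for currents of finite mass.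
[cite: Federer1969, 4.1.7] -/
theorem Current.abs_apply_le_mul_toReal_mass (T : Current Ω m) (hT : T.mass ≠ ∞)
    {φ : TestForm Ω m} {c : ℝ} (hc : 0 < c) (hφ : ∀ x, ‖φ x‖ ≤ c) :
    |T φ| ≤ c * T.mass.toReal := by
  have h := T.ofReal_abs_apply_le_mul_mass hc hφ
  rw [← ENNReal.ofReal_toReal hT, ← ENNReal.ofReal_mul hc.le] at h
  exact (ENNReal.ofReal_le_ofReal_iff (by positivity)).1 h

/-- **A current of mass zero is zero.** [cite: Federer1969, 4.1.7] -/
theorem Current.eq_zero_of_mass_eq_zero (T : Current Ω m) (h : T.mass = 0) : T = 0 := by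
  ext φ
  obtain ⟨C, hC, hφ⟩ := TestForm.exists_pos_forall_norm_le φ
  have h1 := T.ofReal_abs_apply_le_mul_mass hC hφ
  rw [h, mul_zero, nonpos_iff_eq_zero, ENNReal.ofReal_eq_zero] at h1
  simpa using abs_nonpos_iff.1 h1

/-! ### Lower semicontinuity of `𝐌` and `𝐍` under weak convergence -/

/-- `liminf u + liminf v ≤ liminf (u + v)` in `ℝ≥0∞`. [folklore] -/
private theorem liminf_add_liminf_le {ι : Type*} (l : Filter ι) (u v : ι → ℝ≥0∞) :
    liminf u l + liminf v l ≤ liminf (fun i => u i + v i) l := by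
  rw [liminf_eq_iSup_iInf, liminf_eq_iSup_iInf, liminf_eq_iSup_iInf]
  refine ENNReal.biSup_add_biSup_le' ⟨univ, univ_mem⟩ ⟨univ, univ_mem⟩ fun s hs t ht => ?_
  refine le_trans ?_ (le_iSup₂ (f := fun (r : Set ι) (_ : r ∈ l) => ⨅ a ∈ r, (u a + v a))
    (s ∩ t) (inter_mem hs ht))
  exact le_iInf₂ fun a ha => add_le_add (iInf₂_le a ha.1) (iInf₂_le a ha.2)

/-- **Lower semicontinuity of mass**: if `Tᵢ → T'` weakly (`Tᵢ(φ) → T'(φ)` for every test form)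
then `𝐌(T') ≤ liminf 𝐌(Tᵢ)` — `𝐌` is a supremum of weakly continuous functionals.
[cite: Federer1969, 4.1.7 (used in the proof of 4.2.17)] -/
theorem Current.mass_le_liminf {ι : Type*} {l : Filter ι} [l.NeBot] {T : ι → Current Ω m}
    {T' : Current Ω m} (h : ∀ φ, Tendsto (fun i => T i φ) l (𝓝 (T' φ))) :
    T'.mass ≤ liminf (fun i => (T i).mass) l := by
  refine iSup₂_le fun φ hφ => ?_
  have h1 : Tendsto (fun i => ENNReal.ofReal (T i φ)) l (𝓝 (ENNReal.ofReal (T' φ))) :=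
    (ENNReal.continuous_ofReal.tendsto _).comp (h φ)
  rw [← h1.liminf_eq]
  exact liminf_le_liminf (Eventually.of_forall fun i => (T i).ofReal_apply_le_mass hφ)

/-- The boundary operator is weakly continuous: `Tᵢ → T'` weakly implies `∂Tᵢ → ∂T'` weakly
(`∂T(φ) = T(dφ)`). [cite: Federer1969, 4.1.7] -/
theorem Current.tendsto_boundary_apply {ι : Type*} {l : Filter ι} {T : ι → Current Ω (m + 1)}
    {T' : Current Ω (m + 1)} (h : ∀ φ, Tendsto (fun i => T i φ) l (𝓝 (T' φ)))
    (φ : TestForm Ω m) : Tendsto (fun i => (T i).boundary φ) l (𝓝 (T'.boundary φ)) :=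
  h _

/-- **Lower semicontinuity of normal mass** `𝐍 = 𝐌 + 𝐌 ∘ ∂` under weak convergence ("Since 𝐍 is
a lowersemicontinuous function, the set in (1) is 𝐅_K complete").
[cite: Federer1969, 4.2.17 (proof)] -/
theorem Current.normalMass_le_liminf {ι : Type*} {l : Filter ι} [l.NeBot]
    {T : ι → Current Ω (m + 1)} {T' : Current Ω (m + 1)}
    (h : ∀ φ, Tendsto (fun i => T i φ) l (𝓝 (T' φ))) :
    T'.normalMass ≤ liminf (fun i => (T i).normalMass) l :=
  calc T'.normalMass = T'.mass + T'.boundary.mass := rfl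
    _ ≤ liminf (fun i => (T i).mass) l + liminf (fun i => (T i).boundary.mass) l :=
        add_le_add (Current.mass_le_liminf h)
          (Current.mass_le_liminf (Current.tendsto_boundary_apply h))
    _ ≤ liminf (fun i => (T i).mass + (T i).boundary.mass) l := liminf_add_liminf_le l _ _

/-! ### The integral flat norm dominates weak convergence -/

section Euclidean

variable {V : Type*} [NormedAddCommGroup V] [InnerProductSpace ℝ V] [MeasurableSpace V]
  [BorelSpace V] {Ω : Opens V} {m : ℕ}

/-- **`T(φ) ≤ 𝓕(T)` when `‖φ‖ ≤ 1` and `‖dφ‖ ≤ 1` pointwise**: for every decomposition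
`T = R + ∂S`, "T(φ) = (T − ∂S)(φ) + S(dφ) ≤ 𝐌(T − ∂S) + 𝐌(S) whenever 𝐅_K(φ) ≤ 1".
[cite: Federer1969, 4.1.12 (with 4.1.24)] -/
theorem Current.ofReal_apply_le_integralFlatNorm (T : Current Ω m) {φ : TestForm Ω m}
    (hφ : ∀ x, ‖φ x‖ ≤ 1) (hdφ : ∀ x, ‖TestForm.extDerivCLM φ x‖ ≤ 1) :
    ENNReal.ofReal (T φ) ≤ T.integralFlatNorm := by
  refine le_iInf fun R => le_iInf fun S => le_iInf fun h => ?_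
  obtain ⟨-, -, rfl⟩ := h
  calc ENNReal.ofReal ((R + S.boundary) φ)
      = ENNReal.ofReal (R φ + S (TestForm.extDerivCLM φ)) := rfl
    _ ≤ ENNReal.ofReal (R φ) + ENNReal.ofReal (S (TestForm.extDerivCLM φ)) :=
        ENNReal.ofReal_add_le
    _ ≤ R.mass + S.mass :=
        add_le_add (R.ofReal_apply_le_mass hφ) (S.ofReal_apply_le_mass hdφ)

/-- `𝓕(T) ≤ 𝐌(T)` for a rectifiable current `T` (the decomposition `T = T + ∂0`).
[cite: Federer1969, 4.1.24] -/
theorem Current.integralFlatNorm_le_mass {T : Current Ω m} (hT : T.IsRectifiable) :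
    T.integralFlatNorm ≤ T.mass := by
  have h : T = T + (0 : Current Ω (m + 1)).boundary := by
    rw [Current.boundary_zero, add_zero]
  calc T.integralFlatNorm ≤ T.mass + (0 : Current Ω (m + 1)).mass :=
        iInf_le_of_le T (iInf_le_of_le 0
          (iInf_le_of_le ⟨hT, Current.isRectifiable_zero, h⟩ le_rfl))
    _ = T.mass := by simp

/-- `𝓕(∂S) ≤ 𝐌(S)` for a rectifiable current `S` (the decomposition `∂S = 0 + ∂S`); in
particular the boundary operator is `𝓕`-Lipschitz on `𝓡_{m+1}`. [cite: Federer1969, 4.1.24] -/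
theorem Current.integralFlatNorm_boundary_le_mass {S : Current Ω (m + 1)} (hS : S.IsRectifiable) :
    S.boundary.integralFlatNorm ≤ S.mass := by
  have h : S.boundary = 0 + S.boundary := (zero_add _).symm
  calc S.boundary.integralFlatNorm ≤ (0 : Current Ω m).mass + S.mass :=
        iInf_le_of_le 0 (iInf_le_of_le S
          (iInf_le_of_le ⟨Current.isRectifiable_zero, hS, h⟩ le_rfl))
    _ = S.mass := by simp

/-- **Flat convergence implies weak convergence**: if `𝓕(Tᵢ − T') → 0` then `Tᵢ(φ) → T'(φ)` for
every test form `φ` (rescale `φ` so that `‖φ‖, ‖dφ‖ ≤ 1` and use `|T(φ)| ≤ 𝓕(T)`).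
[cite: Federer1969, 4.1.12 and 4.1.24] -/
theorem Current.tendsto_apply_of_tendsto_integralFlatNorm {ι : Type*} {l : Filter ι}
    {T : ι → Current Ω m} {T' : Current Ω m}
    (h : Tendsto (fun i => (T i - T').integralFlatNorm) l (𝓝 0)) (φ : TestForm Ω m) :
    Tendsto (fun i => T i φ) l (𝓝 (T' φ)) := by
  obtain ⟨C₁, hC₁, h₁⟩ := TestForm.exists_pos_forall_norm_le φ
  obtain ⟨C₂, -, h₂⟩ := TestForm.exists_pos_forall_norm_le (TestForm.extDerivCLM φ)
  set C : ℝ := max C₁ C₂ with hC_def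
  have hC : 0 < C := lt_max_of_lt_left hC₁
  have hCinv : ‖C⁻¹‖ = C⁻¹ := by rw [norm_inv, Real.norm_of_nonneg hC.le]
  set ψ : TestForm Ω m := C⁻¹ • φ with hψ_def
  have hψ : ∀ x, ‖ψ x‖ ≤ 1 := fun x => by
    rw [hψ_def, show (C⁻¹ • φ) x = C⁻¹ • φ x from rfl, norm_smul, hCinv]
    exact (inv_mul_le_iff₀ hC).2 (by rw [mul_one]; exact (h₁ x).trans (le_max_left C₁ C₂))
  have hdψ : ∀ x, ‖TestForm.extDerivCLM ψ x‖ ≤ 1 := fun x => by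
    rw [hψ_def, map_smul, show (C⁻¹ • TestForm.extDerivCLM φ) x = C⁻¹ • TestForm.extDerivCLM φ x
      from rfl, norm_smul, hCinv]
    exact (inv_mul_le_iff₀ hC).2 (by rw [mul_one]; exact (h₂ x).trans (le_max_right C₁ C₂))
  -- `|(Tᵢ - T')(ψ)| ≤ 𝓕(Tᵢ - T')`
  have key : ∀ i, ENNReal.ofReal |(T i - T') ψ| ≤ (T i - T').integralFlatNorm := by
    intro i
    rcases le_total 0 ((T i - T') ψ) with h0 | h0
    · rw [abs_of_nonneg h0]
      exact (T i - T').ofReal_apply_le_integralFlatNorm hψ hdψ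
    · rw [abs_of_nonpos h0, ← map_neg]
      refine (T i - T').ofReal_apply_le_integralFlatNorm (fun x => by simpa using hψ x) fun x => ?_
      rw [map_neg]
      simpa using hdψ x
  have h3 : Tendsto (fun i => ENNReal.ofReal |(T i - T') ψ|) l (𝓝 0) :=
    tendsto_of_tendsto_of_tendsto_of_le_of_le tendsto_const_nhds h (fun _ => bot_le) key
  have h4 : Tendsto (fun i => |(T i - T') ψ|) l (𝓝 0) := by
    have := (ENNReal.tendsto_toReal ENNReal.zero_ne_top).comp h3
    simpa [Function.comp_def, ENNReal.toReal_ofReal (abs_nonneg _)] using this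
  have h5 : Tendsto (fun i => (T i - T') ψ) l (𝓝 0) :=
    squeeze_zero_norm (fun i => (Real.norm_eq_abs _).le) h4
  have h6 : Tendsto (fun i => C * (T i - T') ψ) l (𝓝 0) := by
    simpa using h5.const_mul C
  have h7 : ∀ i, C * (T i - T') ψ = T i φ - T' φ := fun i => by
    rw [hψ_def, map_smul, smul_eq_mul, ← mul_assoc, mul_inv_cancel₀ hC.ne', one_mul]
    rfl
  simp_rw [h7] at h6
  exact tendsto_sub_nhds_zero_iff.1 h6

/-- **Lower semicontinuity of `𝐍` along flat convergence, in the form used in 4.2.17 (2)**: if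
`𝐍(Tᵢ) ≤ c` eventually and `𝓕(Tᵢ − T') → 0`, then `𝐍(T') ≤ c` (the limit stays in
`{T : 𝐍(T) ≤ c}`). [cite: Federer1969, 4.2.17 (proof)] -/
theorem Current.normalMass_le_of_tendsto_integralFlatNorm {ι : Type*} {l : Filter ι} [l.NeBot]
    {T : ι → Current Ω (m + 1)} {T' : Current Ω (m + 1)} {c : ℝ≥0∞}
    (hc : ∀ᶠ i in l, (T i).normalMass ≤ c)
    (h : Tendsto (fun i => (T i - T').integralFlatNorm) l (𝓝 0)) : T'.normalMass ≤ c :=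
  (Current.normalMass_le_liminf fun φ => Current.tendsto_apply_of_tendsto_integralFlatNorm h φ).trans
    (liminf_le_of_frequently_le' hc.frequently)

/-- Likewise for mass: if `𝐌(Tᵢ) ≤ c` eventually and `𝓕(Tᵢ − T') → 0`, then `𝐌(T') ≤ c`.
[cite: Federer1969, 4.2.17 (proof)] -/
theorem Current.mass_le_of_tendsto_integralFlatNorm {ι : Type*} {l : Filter ι} [l.NeBot]
    {T : ι → Current Ω m} {T' : Current Ω m} {c : ℝ≥0∞}
    (hc : ∀ᶠ i in l, (T i).mass ≤ c)
    (h : Tendsto (fun i => (T i - T').integralFlatNorm) l (𝓝 0)) : T'.mass ≤ c :=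
  (Current.mass_le_liminf fun φ => Current.tendsto_apply_of_tendsto_integralFlatNorm h φ).trans
    (liminf_le_of_frequently_le' hc.frequently)

end Euclidean

/-! ### Localisation: supports of currents (Federer 4.1.1) -/

section Support

variable {E : Type*} [NormedAddCommGroup E] [NormedSpace ℝ E] [FiniteDimensional ℝ E]
  {Ω : Opens E} {m : ℕ}

open scoped Manifold ContDiff in
/-- **Localisation of currents** (smooth partitions of unity): if every point of `spt φ` has a
neighbourhood `U` with `T(ψ) = 0` whenever `spt ψ ⊆ U`, then `T(φ) = 0` — cover `spt φ` by finitely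
many such `U`, write `φ = Σ ρᵢ φ` with a smooth partition of unity `ρ` subordinate to the cover.
[cite: Federer1969, 4.1.1] -/
theorem Current.apply_eq_zero_of_forall_exists_nhds (T : Current Ω m) (φ : TestForm Ω m)
    (h : ∀ x ∈ tsupport ⇑φ, ∃ U ∈ 𝓝 x, ∀ ψ : TestForm Ω m, tsupport ⇑ψ ⊆ U → T ψ = 0) :
    T φ = 0 := by
  choose! U hU hTU using h
  have hK : IsCompact (tsupport ⇑φ) := φ.hasCompactSupport
  obtain ⟨t, ht⟩ := hK.elim_finite_subcover (fun x : tsupport ⇑φ => interior (U (x : E)))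
    (fun _ => isOpen_interior) fun y hy =>
      mem_iUnion.2 ⟨⟨y, hy⟩, mem_interior_iff_mem_nhds.2 (hU y hy)⟩
  obtain ⟨f, hf⟩ := SmoothPartitionOfUnity.exists_isSubordinate 𝓘(ℝ, E) (isClosed_tsupport ⇑φ)
    (fun x : (t : Set (tsupport ⇑φ)) => interior (U ((x : tsupport ⇑φ) : E)))
    (fun _ => isOpen_interior) (fun y hy => by simpa using ht hy)
  have hsm : ∀ i : ↥(↑t : Set ↥(tsupport ⇑φ)), ContDiff ℝ ∞ (fun x => f i x • φ x) := fun i =>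
    (contMDiff_iff_contDiff.1 (f i).contMDiff).smul φ.contDiff
  let ψ : ↥(↑t : Set ↥(tsupport ⇑φ)) → TestForm Ω m := fun i =>
    ⟨fun x => f i x • φ x, hsm i, φ.hasCompactSupport.smul_left (f := ⇑(f i)),
      (tsupport_smul_subset_right (fun x => f i x) ⇑φ).trans φ.tsupport_subset⟩
  have hψ : ∀ i, T (ψ i) = 0 := fun i =>
    hTU _ (i : tsupport ⇑φ).2 (ψ i)
      (((tsupport_smul_subset_left (fun x => f i x) ⇑φ).trans (hf i)).trans interior_subset)
  have hsum : φ = ∑ i, ψ i := by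
    apply TestFunction.ext
    intro x
    rw [sum_apply]
    change φ x = ∑ i, f i x • φ x
    rw [← Finset.sum_smul]
    by_cases hx : x ∈ tsupport ⇑φ
    · rw [← finsum_eq_sum_of_fintype, f.sum_eq_one hx, one_smul]
    · rw [image_eq_zero_of_notMem_tsupport hx, smul_zero]
  rw [hsum, map_sum]
  simp [hψ]

/-- A current that vanishes near every point of `Ω` is zero ("the complement of spt T is the
largest open W ⊆ U such that T(φ) = 0 whenever spt φ ⊆ W"). [cite: Federer1969, 4.1.1] -/
theorem Current.eq_zero_of_forall_exists_nhds (T : Current Ω m)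
    (h : ∀ x ∈ (Ω : Set E), ∃ U ∈ 𝓝 x, ∀ φ : TestForm Ω m, tsupport ⇑φ ⊆ U → T φ = 0) :
    T = 0 := by
  ext φ
  exact T.apply_eq_zero_of_forall_exists_nhds φ fun x hx => h x (φ.tsupport_subset hx)

/-- **`T(φ) = 0` whenever `spt φ` misses `spt T`.** [cite: Federer1969, 4.1.1] -/
theorem Current.apply_eq_zero_of_disjoint_support (T : Current Ω m) {φ : TestForm Ω m}
    (h : Disjoint (tsupport ⇑φ) T.support) : T φ = 0 :=
  T.apply_eq_zero_of_forall_exists_nhds φ fun _ hx =>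
    T.exists_nhds_of_not_mem_support (φ.tsupport_subset hx) (h.notMem_of_mem_left hx)

/-- **A current with empty support is zero.** [cite: Federer1969, 4.1.1] -/
theorem Current.eq_zero_of_support_eq_empty (T : Current Ω m) (h : T.support = ∅) : T = 0 := by
  ext φ
  exact T.apply_eq_zero_of_disjoint_support (by simp [h])

/-- The support of a non-zero current is non-empty. [cite: Federer1969, 4.1.1] -/
theorem Current.support_nonempty {T : Current Ω m} (hT : T ≠ 0) : T.support.Nonempty :=
  nonempty_iff_ne_empty.2 fun h => hT (T.eq_zero_of_support_eq_empty h)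

end Support

/-! ### Negation: `𝓡_m`, `𝐈_m`, `𝓕_m` are closed under `T ↦ -T`, and `𝓕(-T) = 𝓕(T)` -/

section NegGeneral

variable {E : Type*} [NormedAddCommGroup E] [NormedSpace ℝ E] {Ω : Opens E} {m : ℕ}

/-- `spt (-T) = spt T`. [folklore] -/
@[simp] theorem Current.support_neg (T : Current Ω m) : (-T).support = T.support := by
  ext x
  simp [Current.support]

variable [MeasurableSpace E] [OpensMeasurableSpace E]

/-- `μ ∧ (-η) = -(μ ∧ η)` (including the junk case: `-η` is locally integrable iff `η` is).
[cite: Federer1969, 4.1.7] -/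
theorem vectorCurrent_neg (μ : Measure E) (η : E → Multivector E m) :
    (vectorCurrent μ (fun x => -η x) : Current Ω m) = -vectorCurrent μ η := by
  by_cases hη : LocallyIntegrableOn η (Ω : Set E) μ
  · have hη' : LocallyIntegrableOn (fun x => -η x) (Ω : Set E) μ := hη.neg
    ext φ
    rw [neg_apply, vectorCurrent_apply hη', vectorCurrent_apply hη,
      ← integral_neg]
    simp
  · have hη' : ¬ LocallyIntegrableOn (fun x => -η x) (Ω : Set E) μ := fun h =>
      hη (by have h' := h.neg; simp only [Pi.neg_def, neg_neg] at h'; exact h')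
    rw [vectorCurrent_of_not_locallyIntegrableOn hη, vectorCurrent_of_not_locallyIntegrableOn hη',
      neg_zero]

end NegGeneral

section Integration

variable {V : Type*} [NormedAddCommGroup V] [NormedSpace ℝ V] [MeasurableSpace V] [BorelSpace V]
  {Ω : Opens V} {m : ℕ}

/-- `[W, -θ, ξ] = -[W, θ, ξ]`. [cite: Federer1969, 4.1.28 (4) with 4.1.7] -/
theorem currentOfIntegration_neg (W : Set V) (θ : V → ℤ) (ξ : V → Fin m → V) :
    (currentOfIntegration W (fun x => -θ x) ξ : Current Ω m) = -currentOfIntegration W θ ξ := by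
  unfold currentOfIntegration
  rw [← vectorCurrent_neg]
  congr 1
  funext x
  ext φ
  simp

/-- The support of a current of integration `[W, θ, ξ]` lies in the closure of its carrier `W`.
[cite: Federer1969, 4.1.28 (4) with 4.1.1] -/
theorem support_currentOfIntegration_subset_closure (W : Set V) (θ : V → ℤ) (ξ : V → Fin m → V) :
    (currentOfIntegration W θ ξ : Current Ω m).support ⊆ closure W := by
  intro x hx
  by_contra hxW
  by_cases hint : LocallyIntegrableOn (fun x => (θ x : ℝ) • frameVector (ξ x)) (Ω : Set V)
      ((μHE[m] : Measure V).restrict W)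
  · obtain ⟨φ, hφ, hne⟩ := hx.2 (closure W)ᶜ (isClosed_closure.isOpen_compl.mem_nhds hxW)
    apply hne
    rw [currentOfIntegration_apply hint]
    refine setIntegral_eq_zero_of_forall_eq_zero fun y hy => ?_
    have : φ y = 0 := image_eq_zero_of_notMem_tsupport fun h => hφ h (subset_closure hy)
    simp [this]
  · have h0 : (currentOfIntegration W θ ξ : Current Ω m) = 0 :=
      vectorCurrent_of_not_locallyIntegrableOn hint
    rw [h0, Current.support_zero] at hx
    exact hx

/-- **Mass of a current of integration**: `𝐌([W, θ, ξ]) ≤ ∫_W |θ| d𝓗^m` when the frames `ξ(x)`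
have `‖ξ₁(x) ∧ ⋯ ∧ ξₘ(x)‖ ≤ 1` almost everywhere (e.g. orthonormal frames), by
`|θ φ(ξ₁,…,ξₘ)| ≤ |θ| ‖φ‖ ∏ ‖ξᵢ‖`. [cite: Federer1969, 4.1.28 (5) ("‖T‖ = 𝓗^m ⌞ Θ^m(‖T‖,·)")] -/
theorem mass_currentOfIntegration_le (W : Set V) (θ : V → ℤ) (ξ : V → Fin m → V)
    (hξ : ∀ᵐ x ∂((μHE[m] : Measure V).restrict W), ‖frameVector (ξ x)‖ ≤ 1) :
    (currentOfIntegration W θ ξ : Current Ω m).mass ≤ ∫⁻ x in W, ‖(θ x : ℝ)‖ₑ ∂(μHE[m] : Measure V) := by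
  by_cases hint : LocallyIntegrableOn (fun x => (θ x : ℝ) • frameVector (ξ x)) (Ω : Set V)
      ((μHE[m] : Measure V).restrict W)
  · refine iSup₂_le fun φ hφ => ?_
    rw [currentOfIntegration_apply hint]
    refine (ENNReal.ofReal_le_ofReal (le_abs_self _)).trans ?_
    rw [← Real.norm_eq_abs, ofReal_norm]
    refine (enorm_integral_le_lintegral_enorm _).trans (lintegral_mono_ae ?_)
    filter_upwards [hξ] with x hx
    rw [enorm_mul]
    refine mul_le_of_le_one_right' ?_
    rw [← ofReal_norm, ENNReal.ofReal_le_one, Real.norm_eq_abs]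
    calc |φ x (ξ x)| = ‖frameVector (ξ x) (φ x)‖ := by simp [Real.norm_eq_abs]
      _ ≤ ‖frameVector (ξ x)‖ * ‖φ x‖ := ContinuousLinearMap.le_opNorm _ _
      _ ≤ 1 * 1 := mul_le_mul hx (hφ x) (norm_nonneg _) zero_le_one
      _ = 1 := one_mul 1
  · have h0 : (currentOfIntegration W θ ξ : Current Ω m) = 0 :=
      vectorCurrent_of_not_locallyIntegrableOn hint
    rw [h0, Current.mass_zero]
    exact bot_le

end Integration

section NegEuclidean

variable {V : Type*} [NormedAddCommGroup V] [InnerProductSpace ℝ V] [MeasurableSpace V]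
  [BorelSpace V] {Ω : Opens V} {m : ℕ}

omit [MeasurableSpace V] [BorelSpace V] in
/-- The simple `m`-vector of an orthonormal frame has norm `≤ 1` (as a functional on covectors:
`|φ(v₁,…,vₘ)| ≤ ‖φ‖ ∏ ‖vᵢ‖ = ‖φ‖`). [folklore] -/
theorem norm_frameVector_le_one {v : Fin m → V} (hv : Orthonormal ℝ v) :
    ‖frameVector v‖ ≤ 1 := by
  refine ContinuousLinearMap.opNorm_le_bound _ zero_le_one fun φ => ?_
  rw [frameVector_apply, one_mul]
  calc ‖φ v‖ ≤ ‖φ‖ * ∏ i, ‖v i‖ := φ.le_opNorm v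
    _ = ‖φ‖ := by simp [hv.norm_eq_one]

omit [MeasurableSpace V] [BorelSpace V] in
set_option maxSynthPendingDepth 3 in
/-- **`‖v₁ ∧ ⋯ ∧ vₘ‖ = 1` for an orthonormal frame** (mass and comass are dual norms and simple unit
`m`-vectors have mass `1`): the volume form of the oriented `m`-plane `span v`, pulled back along
the orthogonal projection onto it, is an `m`-covector of comass `≤ 1` (Hadamard's inequality
`|vol(w₁,…,wₘ)| ≤ ∏ ‖wᵢ‖`) taking the value `±1` on `v`. [cite: Federer1969, 1.8.1 with 4.1.28] -/
theorem norm_frameVector_eq_one {v : Fin m → V} (hv : Orthonormal ℝ v) : ‖frameVector v‖ = 1 := by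
  classical
  refine le_antisymm (norm_frameVector_le_one hv) ?_
  -- the oriented plane `P = span v`
  haveI hfin : FiniteDimensional ℝ (Submodule.span ℝ (Set.range v)) :=
    FiniteDimensional.span_of_finite ℝ (Set.finite_range v)
  haveI hfact : Fact (Module.finrank ℝ (Submodule.span ℝ (Set.range v)) = m) :=
    ⟨by rw [finrank_span_eq_card hv.linearIndependent, Fintype.card_fin]⟩
  let b : Module.Basis (Fin m) ℝ (Submodule.span ℝ (Set.range v)) :=
    Module.Basis.span hv.linearIndependent
  have hb : ∀ i, (b i : V) = v i := fun i =>
    congrArg Subtype.val (Module.Basis.span_apply hv.linearIndependent i)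
  have hbon : Orthonormal ℝ b := by
    rw [orthonormal_iff_ite] at hv ⊢
    intro i j
    rw [Submodule.coe_inner, hb, hb]
    exact hv i j
  let o : Orientation ℝ (Submodule.span ℝ (Set.range v)) (Fin m) := b.orientation
  let π : V →L[ℝ] (Submodule.span ℝ (Set.range v)) :=
    (Submodule.span ℝ (Set.range v)).orthogonalProjectionOnto
  have hπ : ∀ w : V, ‖π w‖ ≤ ‖w‖ := fun w =>
    (π.le_opNorm w).trans (by
      have := (Submodule.span ℝ (Set.range v)).orthogonalProjectionOnto_norm_le
      nlinarith [norm_nonneg w])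
  -- the covector `φ₀ = vol_P ∘ π`
  let A : V [⋀^Fin m]→ₗ[ℝ] ℝ := o.volumeForm.compLinearMap (π : V →ₗ[ℝ] _)
  have hA : ∀ w : Fin m → V, ‖A w‖ ≤ 1 * ∏ i, ‖w i‖ := by
    intro w
    rw [one_mul, Real.norm_eq_abs, AlternatingMap.compLinearMap_apply]
    refine (o.abs_volumeForm_apply_le _).trans (Finset.prod_le_prod (fun i _ => norm_nonneg _)
      fun i _ => ?_)
    exact hπ (w i)
  let φ₀ : Covector V m := A.mkContinuous 1 hA
  have hφ₀A : ∀ w, φ₀ w = A w := fun w => rfl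
  have hφ₀ : ‖φ₀‖ ≤ 1 := φ₀.opNorm_le_bound zero_le_one fun w => by rw [hφ₀A]; exact hA w
  -- its value on `v` is `±1`
  let ob : OrthonormalBasis (Fin m) ℝ (Submodule.span ℝ (Set.range v)) := b.toOrthonormalBasis hbon
  have hval : |φ₀ v| = 1 := by
    have e : φ₀ v = o.volumeForm ob := by
      rw [hφ₀A, AlternatingMap.compLinearMap_apply]
      congr 1
      funext i
      have h1 : (ob i : Submodule.span ℝ (Set.range v)) = b i := by
        rw [Module.Basis.coe_toOrthonormalBasis]
      rw [h1, ContinuousLinearMap.coe_coe, ← hb i]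
      exact Submodule.orthogonalProjectionOnto_mem_subspace_eq_self (b i)
    rw [e]
    exact o.abs_volumeForm_apply_of_orthonormal ob
  calc (1 : ℝ) = |φ₀ v| := hval.symm
    _ = ‖frameVector v φ₀‖ := by rw [frameVector_apply, Real.norm_eq_abs]
    _ ≤ ‖frameVector v‖ * ‖φ₀‖ := (frameVector v).le_opNorm φ₀
    _ ≤ ‖frameVector v‖ * 1 := by gcongr
    _ = ‖frameVector v‖ := mul_one _

/-- Admissible data stay admissible under `θ ↦ -θ`. [cite: Federer1969, 4.1.28 (4)] -/
theorem IsRectifiableData.neg {W : Set V} {θ : V → ℤ} {ξ : V → Fin m → V}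
    (h : IsRectifiableData Ω m W θ ξ) : IsRectifiableData Ω m W (fun x => -θ x) ξ := by
  obtain ⟨h1, h2, h3, h4, h5⟩ := h
  refine ⟨h1, h2, h3, ?_, h5⟩
  have : (fun x => (((-θ x : ℤ) : ℝ)) • frameVector (ξ x)) =
      fun x => -((θ x : ℝ) • frameVector (ξ x)) := by
    funext x
    ext φ
    simp
  rw [this]
  exact h4.neg

/-- **Mass of a rectifiable current of integration**: for admissible data,
`𝐌([W, θ, ξ]) ≤ ∫_W |θ| d𝓗^m`. [cite: Federer1969, 4.1.28 (5)] -/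
theorem IsRectifiableData.mass_le {W : Set V} {θ : V → ℤ} {ξ : V → Fin m → V}
    (h : IsRectifiableData Ω m W θ ξ) :
    (currentOfIntegration W θ ξ : Current Ω m).mass ≤
      ∫⁻ x in W, ‖(θ x : ℝ)‖ₑ ∂(μHE[m] : Measure V) :=
  mass_currentOfIntegration_le W θ ξ (h.2.2.2.2.mono fun _ hx => norm_frameVector_le_one hx.1)

/-- `𝓡^{loc}_m` is closed under negation. [cite: Federer1969, 4.1.24] -/
theorem Current.IsLocallyRectifiable.neg {T : Current Ω m} (h : T.IsLocallyRectifiable) :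
    (-T).IsLocallyRectifiable := by
  obtain ⟨W, θ, ξ, hd, rfl⟩ := h
  exact ⟨W, fun x => -θ x, ξ, hd.neg, (currentOfIntegration_neg W θ ξ).symm⟩

/-- `𝓡_m` is closed under negation ("𝓡_{m,K}(U) is an additive subgroup").
[cite: Federer1969, 4.1.24] -/
theorem Current.IsRectifiable.neg {T : Current Ω m} (h : T.IsRectifiable) : (-T).IsRectifiable :=
  ⟨h.1.neg, by rw [Current.support_neg]; exact h.2⟩

/-- `𝐈_m` is closed under negation. [cite: Federer1969, 4.1.24] -/
theorem Current.IsIntegral.neg : ∀ {m : ℕ} {T : Current Ω m}, T.IsIntegral → (-T).IsIntegral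
  | 0, _, h => Current.IsRectifiable.neg h
  | _ + 1, _, h => ⟨Current.IsRectifiable.neg h.1, by
      rw [Current.boundary_neg]; exact Current.IsRectifiable.neg h.2⟩

/-- `𝓕_m` is closed under negation. [cite: Federer1969, 4.1.24] -/
theorem Current.IsIntegralFlatChain.neg {T : Current Ω m} (h : T.IsIntegralFlatChain) :
    (-T).IsIntegralFlatChain := by
  obtain ⟨R, S, hR, hS, rfl⟩ := h
  exact ⟨-R, -S, hR.neg, hS.neg, by rw [Current.boundary_neg, neg_add]⟩

/-- **`𝓕(-T) = 𝓕(T)`** (decompositions `T = R + ∂S` and `-T = (-R) + ∂(-S)` correspond, and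
`𝐌(-R) = 𝐌(R)`), so that `(T₁, T₂) ↦ 𝓕(T₁ - T₂)` is symmetric. [cite: Federer1969, 4.1.24] -/
theorem Current.integralFlatNorm_neg (T : Current Ω m) : (-T).integralFlatNorm = T.integralFlatNorm := by
  have key : ∀ T : Current Ω m, (-T).integralFlatNorm ≤ T.integralFlatNorm := by
    intro T
    refine le_iInf fun R => le_iInf fun S => le_iInf fun h => ?_
    obtain ⟨hR, hS, hT⟩ := h
    calc (-T).integralFlatNorm ≤ (-R).mass + (-S).mass :=
          iInf_le_of_le (-R) (iInf_le_of_le (-S) (iInf_le_of_le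
            ⟨hR.neg, hS.neg, by rw [hT, Current.boundary_neg, neg_add]⟩ le_rfl))
      _ = R.mass + S.mass := by rw [Current.mass_neg, Current.mass_neg]
  refine le_antisymm (key T) ?_
  simpa using key (-T)

/-- `𝓕(T₁ - T₂) = 𝓕(T₂ - T₁)`. [cite: Federer1969, 4.1.24] -/
theorem Current.integralFlatNorm_sub_comm (T₁ T₂ : Current Ω m) :
    (T₁ - T₂).integralFlatNorm = (T₂ - T₁).integralFlatNorm := by
  rw [← neg_sub, Current.integralFlatNorm_neg]


/-- **`𝓕` separates points**: `𝓕(T) = 0 ⟹ T = 0` (`|T(φ)| ≤ 𝓕(T)` for normalised `φ`), so that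
`(T₁, T₂) ↦ 𝓕(T₁ − T₂)` is definite ("we metrize 𝓕_{m,K}(U) by letting the distance between T₁ and
T₂ equal 𝓕_K(T₁ − T₂)"). [cite: Federer1969, 4.1.24] -/
theorem Current.eq_zero_of_integralFlatNorm_eq_zero (T : Current Ω m) (h : T.integralFlatNorm = 0) :
    T = 0 := by
  have h1 : Tendsto (fun _ : ℕ => (T - 0).integralFlatNorm) atTop (𝓝 0) := by
    rw [sub_zero, h]
    exact tendsto_const_nhds
  ext φ
  have h2 := Current.tendsto_apply_of_tendsto_integralFlatNorm h1 φ
  exact tendsto_nhds_unique tendsto_const_nhds h2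

end NegEuclidean

end Literature.Geometry.GeometricMeasureTheory
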